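import Literature.NumberTheory.Sieve.ParityBarrierLevelProofs
import Literature.NumberTheory.Sieve.LevelOfDistributionProofs
import HarnessLib

/-!
# Primes in progressions to a fixed modulus: the `π`-form with the saving `(log x)^{-2}`

Topic `Literature/NumberTheory/Sieve`. Everything here is PROVED (no definitions, no named facts).
For a FIXED modulus `q ≥ 1` we read off the tree's Bombieri–Vinogradov theorem in `π`-form
(`BombieriVinogradovStatement_holds`, `BombieriVinogradovStatement.primesHaveLevelPi`, file
`LevelOfDistributionProofs.lean`) the prime number theorem for the progressions `a (mod q)` with an
explicit power-of-log saving, in the two shapes used by sieve iterations over Buchstab's identity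
(`RoughOmegaCellsClasses*.lean`):

* `exists_abs_primeCountingDisc_le` — there is `C = C_q ≥ 0` with
  `|π(n; q, a) − π(n)/φ(q)| ≤ C x/log² x` for all real `x ≥ 2`, all integers `n ≤ x` and all reduced
  `a` (`primeCountingDisc q a n`; a single modulus lies in the Bombieri–Vinogradov range `q ≤ x^{1/8}`
  for all large `x`, the summands of the level-of-distribution sum are non-negative, and small `x` are
  covered by the trivial bound `n + 1`);
* `primeCountingDisc_sub_eq` — telescoping: `π-disc(m') − π-disc(m)` is the class discrepancy of the
  primes of `(m, m']`;
* `abs_primes_class_sub_le` — hence for `2 ≤ Y ≤ X` and `(c, q) = 1`,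
  `|#{⌈Y⌉ ≤ p ≤ ⌊X⌋ : p ≡ c (q)} − #{⌈Y⌉ ≤ p ≤ ⌊X⌋}/φ(q)| ≤ 2C X/log² Y`.

Only the saving `(log x)^{-2}` is recorded (any fixed power is available the same way from
`PrimesHaveLevelPi`); the constant is ineffective (Siegel).

## References

* H. Iwaniec, E. Kowalski, *Analytic Number Theory*, AMS Coll. Publ. 53 (2004), Thm 17.1 and
  Cor. 5.29. [IwaniecKowalski2004]
-/

open Finset Filter Asymptotics
open scoped Topology

noncomputable section

namespace Literature.NumberTheory.Sieve

/-! ### The discrepancy `π(n; q, a) − π(n)/φ(q)` for a fixed modulus -/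

/-- **PNT in arithmetic progressions, fixed modulus, `π`-form with the saving `(log x)^{-2}`.**
For `q ≥ 1` there is `C ≥ 0` with `|π(n; q, a) − π(n)/φ(q)| ≤ C x/log² x` for all real `x ≥ 2`,
all integers `n ≤ x` and all reduced classes `a` (`primeCountingDisc q a n = π(n; q, a) − π(n)/φ(q)`).
Read off the Bombieri–Vinogradov theorem in `π`-form (level `x^{1/4}`, `A = 2`, `ε = 1/8`): a single
modulus `q` lies in the range `q ≤ x^{1/8}` for all large `x`, and the summands are non-negative; small
`x` are covered by the trivial bound `|π(n; q, a) − π(n)/φ(q)| ≤ n + 1`.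
[cite: IwaniecKowalski2004, Theorem 17.1] -/
theorem exists_abs_primeCountingDisc_le (q : ℕ) (hq : 0 < q) :
    ∃ C : ℝ, 0 ≤ C ∧ ∀ x : ℝ, 2 ≤ x → ∀ n : ℕ, (n : ℝ) ≤ x → ∀ a : (ZMod q)ˣ,
      |primeCountingDisc q a n| ≤ C * x / Real.log x ^ 2 := by
  have hq0 : q ≠ 0 := hq.ne'
  have hPi : PrimesHaveLevelPi (1 / 4) :=
    BombieriVinogradovStatement_holds.primesHaveLevelPi (by norm_num)
  have hO := hPi 2 two_pos (1 / 8) (by norm_num)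
  obtain ⟨c, hc⟩ := hO.bound
  have hev : ∀ᶠ x : ℝ in atTop, (q : ℝ) ≤ x ^ ((1 : ℝ) / 4 - 1 / 8) :=
    (tendsto_rpow_atTop (by norm_num)).eventually_ge_atTop (q : ℝ)
  obtain ⟨x₀, hx₀⟩ := Filter.eventually_atTop.1 (hc.and (hev.and (eventually_ge_atTop (2 : ℝ))))
  have hx₀2 : 2 ≤ x₀ := (hx₀ x₀ le_rfl).2.2
  have hl0 : 0 < Real.log x₀ := Real.log_pos (by linarith)
  refine ⟨max c 0 + 2 * Real.log x₀ ^ 2, by positivity, fun x hx n hnx a => ?_⟩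
  have hx1 : 1 < x := by linarith
  have hlx : 0 < Real.log x := Real.log_pos hx1
  rcases Nat.eq_zero_or_pos n with rfl | hn
  · rw [primeCountingDisc_zero, abs_zero]; positivity
  rcases le_or_gt x₀ x with hxx₀ | hxx₀
  · -- large `x`: Bombieri–Vinogradov
    obtain ⟨hb, hqx, -⟩ := hx₀ x hxx₀
    have hqmem : q ∈ Icc 1 ⌊x ^ ((1 : ℝ) / 4 - 1 / 8)⌋₊ :=
      mem_Icc.mpr ⟨hq, Nat.le_floor hqx⟩
    set E : ℕ → ℝ := fun q => ⨆ y : Set.Icc (1 : ℝ) x, ⨆ a : (ZMod q)ˣ,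
      |(LevelOfDistribution.primeCountingMod q (a : ZMod q).val ⌊(y : ℝ)⌋₊ : ℝ) -
        (Nat.primeCounting ⌊(y : ℝ)⌋₊ : ℝ) / Nat.totient q| with hE
    have hE0 : ∀ q', 0 ≤ E q' := fun q' =>
      Real.iSup_nonneg fun _ => Real.iSup_nonneg fun _ => abs_nonneg _
    have h1 : |primeCountingDisc q a n| ≤ E q := abs_primeCountingDisc_le_iSup hq0 a hn hnx
    have h2 : E q ≤ ∑ q' ∈ Icc 1 ⌊x ^ ((1 : ℝ) / 4 - 1 / 8)⌋₊, E q' :=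
      single_le_sum (f := E) (fun q' _ => hE0 q') hqmem
    have h3 : ∑ q' ∈ Icc 1 ⌊x ^ ((1 : ℝ) / 4 - 1 / 8)⌋₊, E q' ≤ c * (x / Real.log x ^ 2) := by
      have h := hb
      rw [Real.norm_of_nonneg (sum_nonneg fun q' _ => hE0 q'),
        Real.norm_of_nonneg (by positivity), Real.rpow_two] at h
      exact h
    have h4 : c * (x / Real.log x ^ 2) ≤ (max c 0 + 2 * Real.log x₀ ^ 2) * x / Real.log x ^ 2 := by
      rw [mul_div_assoc]
      exact mul_le_mul_of_nonneg_right (by linarith [le_max_left c 0, sq_nonneg (Real.log x₀)])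
        (by positivity)
    linarith
  · -- small `x`: trivial bound
    have h1 : |primeCountingDisc q a n| ≤ 2 * x := by
      refine (abs_primeCountingDisc_le_succ q a n).trans ?_
      have : (1 : ℝ) ≤ n := by exact_mod_cast hn
      linarith
    have hlog : Real.log x ≤ Real.log x₀ := Real.log_le_log (by linarith) hxx₀.le
    have h2 : Real.log x ^ 2 ≤ Real.log x₀ ^ 2 := pow_le_pow_left₀ hlx.le hlog 2
    have h3 : 2 * x ≤ (max c 0 + 2 * Real.log x₀ ^ 2) * x / Real.log x ^ 2 := by
      rw [le_div_iff₀ (by positivity)]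
      have hx0 : 0 ≤ x := by linarith
      have : 2 * x * Real.log x ^ 2 ≤ 2 * x * Real.log x₀ ^ 2 := by gcongr
      nlinarith [le_max_right c 0]
    linarith

/-! ### The cell `Ω = 1`: primes of `[⌈Y⌉, ⌊X⌋]` in a residue class -/

/-- Telescoping the prime-counting discrepancy over `(m, m']`:
`π-disc(m') − π-disc(m) = #{m < p ≤ m' : p prime, p ≡ c} − #{m < p ≤ m' : p prime}/φ(q)`. [folklore] -/
theorem primeCountingDisc_sub_eq (q c : ℕ) {m m' : ℕ} (hmm' : m ≤ m') :
    primeCountingDisc q (c : ZMod q) m' - primeCountingDisc q (c : ZMod q) m =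
      (#((Ioc m m').filter (fun p => p.Prime ∧ p ≡ c [MOD q])) : ℝ) -
        (#((Ioc m m').filter Nat.Prime) : ℝ) / Nat.totient q := by
  have hsplit : primeCountingDisc q (c : ZMod q) m' - primeCountingDisc q (c : ZMod q) m =
      ∑ n ∈ Ioc m m', (if n.Prime then apIndicator q (c : ZMod q) n - 1 / (Nat.totient q : ℝ)
        else 0) := by
    unfold primeCountingDisc
    rw [Finset.range_eq_Ico, Finset.range_eq_Ico,
      ← Finset.sum_Ico_consecutive _ (Nat.zero_le (m + 1)) (by omega : m + 1 ≤ m' + 1)]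
    have : Finset.Ico (m + 1) (m' + 1) = Ioc m m' := by
      ext n; simp only [Finset.mem_Ico, Finset.mem_Ioc]; omega
    rw [this]; ring
  rw [hsplit]
  have h1 : (#((Ioc m m').filter (fun p => p.Prime ∧ p ≡ c [MOD q])) : ℝ) =
      ∑ n ∈ Ioc m m', if n.Prime then apIndicator q (c : ZMod q) n else 0 := by
    rw [natCast_card_filter]
    refine sum_congr rfl fun n _ => ?_
    by_cases hp : n.Prime
    · simp only [hp, true_and, if_true, apIndicator, ZMod.natCast_eq_natCast_iff]
    · simp [hp]
  have h2 : (#((Ioc m m').filter Nat.Prime) : ℝ) = ∑ n ∈ Ioc m m', if n.Prime then (1 : ℝ) else 0 := by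
    rw [natCast_card_filter]
  rw [h1, h2, sum_div, ← sum_sub_distrib]
  refine sum_congr rfl fun n _ => ?_
  split_ifs <;> ring

/-- **The cell `Ω = 1` in a residue class.** With the constant `C` of
`exists_abs_primeCountingDisc_le`: for `2 ≤ Y ≤ X` and `(c, q) = 1`,
`|#{⌈Y⌉ ≤ p ≤ ⌊X⌋ : p prime, p ≡ c (q)} − #{⌈Y⌉ ≤ p ≤ ⌊X⌋ : p prime}/φ(q)| ≤ 2C X/log² Y`
(two values of the discrepancy, each `≤ C X/log² X ≤ C X/log² Y`). [folklore] -/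
theorem abs_primes_class_sub_le {q : ℕ} {C : ℝ} (hC0 : 0 ≤ C)
    (hC : ∀ x : ℝ, 2 ≤ x → ∀ n : ℕ, (n : ℝ) ≤ x → ∀ a : (ZMod q)ˣ,
      |primeCountingDisc q a n| ≤ C * x / Real.log x ^ 2)
    {X Y : ℝ} (hY : 2 ≤ Y) (hYX : Y ≤ X) {c : ℕ} (hc : c.Coprime q) :
    |(#((Icc ⌈Y⌉₊ ⌊X⌋₊).filter (fun p => p.Prime ∧ p ≡ c [MOD q])) : ℝ) -
        (#((Icc ⌈Y⌉₊ ⌊X⌋₊).filter Nat.Prime) : ℝ) / Nat.totient q| ≤ 2 * C * X / Real.log Y ^ 2 := by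
  have hX2 : 2 ≤ X := hY.trans hYX
  have hX0 : 0 ≤ X := by linarith
  have hlY : 0 < Real.log Y := Real.log_pos (by linarith)
  have hlYX : Real.log Y ≤ Real.log X := Real.log_le_log (by linarith) hYX
  set a : (ZMod q)ˣ := ZMod.unitOfCoprime c hc with ha
  have hav : ((a : ZMod q)) = (c : ZMod q) := by rw [ha, ZMod.coe_unitOfCoprime]
  -- the interval `[⌈Y⌉, ⌊X⌋]` as `(⌈Y⌉ - 1, ⌊X⌋]`
  rcases le_or_gt ⌈Y⌉₊ ⌊X⌋₊ with hle | hgt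
  · have hIcc : Icc ⌈Y⌉₊ ⌊X⌋₊ = Ioc (⌈Y⌉₊ - 1) ⌊X⌋₊ := by
      have hN1 : 1 ≤ ⌈Y⌉₊ := Nat.one_le_iff_ne_zero.mpr (Nat.ceil_pos.mpr (by linarith)).ne'
      ext n; simp only [mem_Icc, mem_Ioc]; omega
    rw [hIcc, ← primeCountingDisc_sub_eq q c (by omega : ⌈Y⌉₊ - 1 ≤ ⌊X⌋₊), ← hav]
    have h1 := hC X hX2 ⌊X⌋₊ (Nat.floor_le hX0) a
    have h2 := hC X hX2 (⌈Y⌉₊ - 1) ?_ a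
    swap
    · have : ((⌈Y⌉₊ - 1 : ℕ) : ℝ) ≤ ⌊X⌋₊ := by exact_mod_cast (by omega : ⌈Y⌉₊ - 1 ≤ ⌊X⌋₊)
      exact this.trans (Nat.floor_le hX0)
    have h3 : C * X / Real.log X ^ 2 ≤ C * X / Real.log Y ^ 2 := by
      apply div_le_div_of_nonneg_left (by positivity) (by positivity)
      exact pow_le_pow_left₀ hlY.le hlYX 2
    calc _ ≤ |primeCountingDisc q a ⌊X⌋₊| + |primeCountingDisc q a (⌈Y⌉₊ - 1)| := abs_sub _ _
      _ ≤ C * X / Real.log Y ^ 2 + C * X / Real.log Y ^ 2 := add_le_add (h1.trans h3) (h2.trans h3)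
      _ = 2 * C * X / Real.log Y ^ 2 := by ring
  · rw [Finset.Icc_eq_empty_of_lt hgt]
    simp only [filter_empty, card_empty, Nat.cast_zero, zero_div, sub_zero, abs_zero]
    positivity

end Literature.NumberTheory.Sieve
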